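import Literature.Topology.FourManifolds.LargeKTrisectionClassification
import Literature.Topology.FourManifolds.BordismFourProjectivePlane
import Literature.Barriers.SmoothPoincare4.WeaklyReducibleGenusThreeStandardProofs
import HarnessLib

/-!
# The homotopy-sphere facts of `LowGenusTrisectionsStandard.lean` from the Meier–Schirmer–Zupan
# classification (`msz_trisection_classification_gk`)

Barrier catalogue `Literature/Barriers/SmoothPoincare4/` (D-0021), companion of
`LowGenusTrisectionsStandard.lean` / `LowGenusTrisectionsStandardProofs.lean` (the named facts
`msz_homotopySphere_gk`, `mz_genus_le_two_homotopySphere_gk` and the barrier statements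
`LowGenusTrisectionBarrier`, `LargeKTrisectionBarrier`) and of
`WeaklyReducibleGenusThreeStandard(Proofs).lean` (Aranda–Zupan's genus-three fact
`az2025_weaklyReducible_genusThree_homotopySphere_gk`, whose proved reductions take
`msz_homotopySphere_gk` as their first hypothesis).  **Everything here is proved; no definition,
no named fact.**

The tree now vendors Meier–Schirmer–Zupan's Theorem 1.2 ITSELF,
`Literature.Topology.FourManifolds.msz_trisection_classification_gk`
(`Literature/Topology/FourManifolds/LargeKTrisectionClassification.lean`): a closed connected
oriented smooth `X` with a `(g; k₀, k₁, k₂)`-trisection and `k₀ ≥ g − 1` is `#^{k′}(S¹ × S³)`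
(`IsCircleProdSum k′ X`, `#⁰ = S⁴`) or a connected sum `M # ℂP²` with `IsCircleProdSum k′ M`
(`k′ = min{k₁, k₂}`).  This file proves that the HOMOTOPY-SPHERE COROLLARY used throughout the
barrier catalogue follows from it, so that the four statements above, hitherto resting on the
separate named fact `msz_homotopySphere_gk`, rest on the classification alone — one debt node
instead of two (the classification is needed anyway, in full, by the route crux it was vendored
for):

* `IsCircleProdSum.not_simplyConnectedSpace_succ`, `IsCircleProdSum.eq_zero_of_simplyConnectedSpace`,
  `IsCircleProdSum.nonempty_diffeomorph_sphere_of_simplyConnectedSpace` — **`#ⁿ(S¹ × S³)` is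
  simply connected only for `n = 0`**: a connected sum `M # (S¹ × S³)` that is simply connected
  has a simply connected summand `S¹ × S³` (Kosinski VI.2, the tree's PROVED
  `IsConnectedSum.simplyConnectedSpace_right`), contradicting `π₁(S¹ × S³) ≠ 1` (PROVED,
  `not_simplyConnectedSpace_circle_prod_sphereThree`); and `#⁰(S¹ × S³)` is `S⁴` by definition.
* `not_isConnectedSum_complexProjectivePlane_of_homotopyEquiv_sphere_four` — **a homotopy
  4-sphere has no `ℂP²` summand**, at every universe: move `M, X : Type u` to their small copies
  in `Type` (`ManifoldShrink.lean`, `IsConnectedSum.of_diffeomorph`, `.of_diffeomorph_left`),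
  where Kosinski's summand theorem (DISCHARGED in the tree,
  `nonempty_homotopyEquiv_sphere_four_left_of_isConnectedSum_holds`, right-hand form) makes `ℂP²`
  a homotopy 4-sphere, which it is not: `H₂(ℂP²; ℤ) ≅ ℤ`
  (`ComplexProjectivePlane.singularHomologyTwoIso`) while `H₂(S⁴; ℤ) = 0`
  (`isZero_singularHomology_sphere_holds`; the same six lines as
  `Literature.Geometry.Riemannian.isEmpty_homotopyEquiv_complexProjectivePlane_sphere_four`,
  re-derived here to keep the Riemannian file out of the imports).
* `msz_homotopySphere_gk_of_classification` (same universe) and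
  `msz_homotopySphere_gk_of_classification_univ` (any two universes, through the PROVED
  `msz_homotopySphere_gk_of_univ`) — **MSZ Thm. 1.2 ⟹ its homotopy-sphere corollary**: a
  trisected homotopy 4-sphere with some `kᵢ ≥ g − 1` is, by the classification
  (`msz_trisection_classification_gk.of_exists`), `#^{k′}(S¹ × S³)` — hence `k′ = 0` and
  `X ≅ S⁴` — or has a `ℂP²` summand — impossible.
* `mz_genus_le_two_homotopySphere_gk_of_classification`,
  `lowGenusTrisectionBarrier_of_classification`, `largeKTrisectionBarrier_of_classification` —
  the genus-`≤ 2` fact and both barrier statements of `LowGenusTrisectionsStandard.lean` from the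
  classification (through the PROVED `…_of_msz_alone` forms: for homotopy spheres
  `g = k₀ + k₁ + k₂`, so genus `≤ 2` forces some `kᵢ ≥ g − 1`).
* `az2025_weaklyReducible_genusThree_homotopySphere_gk_of_classification_of_sep_of_pi1_of_irreducible`
  — Aranda–Zupan's fact at every universe from the classification (any universe), the
  separating splitting fact, the `π₁`-shadow of the non-separating case and the irreducible
  five-chain core, the last three at universe `0`
  (`az2025_weaklyReducible_genusThree_homotopySphere_gk_of_facts_zero_of_pi1_zero_of_irreducible_zero`).

When `msz_trisection_classification_gk` is discharged (at any one universe), the one-liners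
`msz_homotopySphere_gk_of_classification_univ ‹_›`, `mz_genus_le_two_homotopySphere_gk_of_classification ‹_›`
discharge `msz_homotopySphere_gk` and `mz_genus_le_two_homotopySphere_gk` at every universe.

## References

* J. Meier, T. Schirmer, A. Zupan, *Classification of trisections and the Generalized Property R
  Conjecture*, Proc. AMS 144 (2016) 4983–4997 (arXiv:1507.06561), Thm. 1.2, Cor. 1.3,
  Remark 3.12. [MeierSchirmerZupan2016]
* J. Meier, A. Zupan, *Genus-two trisections are standard*, Geom. Topol. 21 (2017), Thm. 1.2
  (arXiv Thm. 1.3). [MeierZupan2017]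
* R. Aranda, A. Zupan, *Manifolds with weakly reducible genus-three trisections are standard*,
  arXiv:2503.04607 (2025), Thm. 1.3, Prop. 2.6, §6. [ArandaZupan2025]
* A. Kosinski, *Differential Manifolds*, Academic Press (1993), Ch. VI §2, Prop. 2.1. [Kosinski1993]
* A. Hatcher, *Algebraic Topology*, CUP (2002), Prop. 1.12, Cor. 2.11, Cor. 2.14, §2.2 p. 140.
  [HatcherAT2002]
-/

noncomputable section

open scoped Manifold ContDiff Topology
open Set CategoryTheory CategoryTheory.Limits ContinuousMap

namespace Literature.Barriers.SmoothPoincare4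

universe u v

open Literature.Topology.FourManifolds Literature.Topology.FourManifolds.Trisection
open Literature.AlgebraicTopology.SingularHomology

/-! ### `#ⁿ(S¹ × S³)` is simply connected only for `n = 0` -/

/-- **A connected sum of `n + 1 ≥ 1` copies of `S¹ × S³` is not simply connected**: it is a
connected sum `M # (S¹ × S³)`, and in dimension `4 ≥ 3` a summand of a simply connected
connected sum is simply connected (Kosinski VI.2; the tree's
`IsConnectedSum.simplyConnectedSpace_right`), while `π₁(S¹ × S³) ≠ 1`
(`not_simplyConnectedSpace_circle_prod_sphereThree`).
[cite: Kosinski1993, Ch. VI §2, Prop. 2.1 and p. 91] [cite: HatcherAT2002, Prop. 1.12] -/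
theorem IsCircleProdSum.not_simplyConnectedSpace_succ {n : ℕ} {P : Type u} [TopologicalSpace P]
    [ChartedSpace (EuclideanSpace ℝ (Fin 4)) P] (h : IsCircleProdSum (n + 1) P) :
    ¬ SimplyConnectedSpace P := by
  intro hP
  obtain ⟨M, _, _, _, _, _, _, _, -, hsum⟩ := isCircleProdSum_succ_iff.mp h
  haveI : SimplyConnectedSpace (Circle × (Metric.sphere (0 : EuclideanSpace ℝ (Fin (3 + 1))) 1)) :=
    hsum.simplyConnectedSpace_right (by rw [finrank_euclideanSpace_fin]; norm_num)
  exact not_simplyConnectedSpace_circle_prod_sphereThree ‹_›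

/-- Hence a SIMPLY CONNECTED connected sum of `n` copies of `S¹ × S³` has `n = 0`.
[cite: Kosinski1993, Ch. VI §2, Prop. 2.1] -/
theorem IsCircleProdSum.eq_zero_of_simplyConnectedSpace {n : ℕ} {P : Type u} [TopologicalSpace P]
    [ChartedSpace (EuclideanSpace ℝ (Fin 4)) P] [hP : SimplyConnectedSpace P]
    (h : IsCircleProdSum n P) : n = 0 := by
  cases n with
  | zero => rfl
  | succ n => exact absurd hP (IsCircleProdSum.not_simplyConnectedSpace_succ h)

/-- **A simply connected `#ⁿ(S¹ × S³)` is diffeomorphic to `S⁴`** (`n = 0` and `#⁰(S¹ × S³) = S⁴`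
by definition, `isCircleProdSum_zero_iff`). [cite: MeierZupan2017, §1 ("#^0(S¹ × S³) = S⁴")]
[cite: Kosinski1993, Ch. VI §2, Prop. 2.1] -/
theorem IsCircleProdSum.nonempty_diffeomorph_sphere_of_simplyConnectedSpace {n : ℕ} {P : Type u}
    [TopologicalSpace P] [ChartedSpace (EuclideanSpace ℝ (Fin 4)) P] [SimplyConnectedSpace P]
    (h : IsCircleProdSum n P) :
    Nonempty (P ≃ₘ⟮𝓡 4, 𝓡 4⟯ (Metric.sphere (0 : EuclideanSpace ℝ (Fin (4 + 1))) 1)) := by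
  obtain rfl := IsCircleProdSum.eq_zero_of_simplyConnectedSpace h
  exact isCircleProdSum_zero_iff.mp h

/-! ### A homotopy 4-sphere has no `ℂP²` summand -/

/-- **A homotopy 4-sphere is not a connected sum `M # ℂP²`** (any universe).  Shrink `M` and `X`
to `Type` along their canonical diffeomorphisms (`ManifoldShrink.diffeomorph`; the connected-sum
relation moves along diffeomorphisms of the glued manifold and of the pieces,
`IsConnectedSum.of_diffeomorph`, `IsConnectedSum.of_diffeomorph_left`); there Kosinski's theorem
"a summand of a homotopy 4-sphere is a homotopy 4-sphere" (DISCHARGED tree fact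
`nonempty_homotopyEquiv_sphere_four_left_of_isConnectedSum_holds`, right-hand form
`nonempty_homotopyEquiv_sphere_four_right_of_isConnectedSum`) gives `ℂP² ≃ₕ S⁴`, whereas
`H₂(ℂP²; ℤ) ≅ ℤ` (`ComplexProjectivePlane.singularHomologyTwoIso`) and `H₂(S⁴; ℤ) = 0`
(`isZero_singularHomology_sphere_holds`), homology being a homotopy invariant
(`singularHomology.isoOfHomotopyEquiv`).
[cite: Kosinski1993, Ch. VI §2, Prop. 2.1] [cite: HatcherAT2002, Cor. 2.11, Cor. 2.14, §2.2 p. 140] -/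
theorem not_isConnectedSum_complexProjectivePlane_of_homotopyEquiv_sphere_four
    {M : Type u} [TopologicalSpace M] [T2Space M] [SecondCountableTopology M]
    [ChartedSpace (EuclideanSpace ℝ (Fin 4)) M] [IsManifold (𝓡 4) ∞ M] [CompactSpace M]
    [ConnectedSpace M]
    {X : Type u} [TopologicalSpace X] [T2Space X] [SecondCountableTopology X]
    [ChartedSpace (EuclideanSpace ℝ (Fin 4)) X] [IsManifold (𝓡 4) ∞ X]
    (h : IsConnectedSum (𝓡 4) (𝓡 4) (𝓡 4) M ComplexProjectivePlane X)
    (e : X ≃ₕ (Metric.sphere (0 : EuclideanSpace ℝ (Fin (4 + 1))) 1)) : False := by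
  haveI : Small.{0} M := small_of_secondCountableTopology M
  haveI : Small.{0} X := small_of_secondCountableTopology X
  let φ : Shrink.{0} M ≃ₘ⟮𝓡 4, 𝓡 4⟯ M := ManifoldShrink.diffeomorph (𝓡 4) M ∞
  let ψ : Shrink.{0} X ≃ₘ⟮𝓡 4, 𝓡 4⟯ X := ManifoldShrink.diffeomorph (𝓡 4) X ∞
  have h₀ : IsConnectedSum (𝓡 4) (𝓡 4) (𝓡 4) (Shrink.{0} M) ComplexProjectivePlane
      (Shrink.{0} X) :=
    (h.of_diffeomorph ψ.symm).of_diffeomorph_left φ.symm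
  obtain ⟨e'⟩ := nonempty_homotopyEquiv_sphere_four_right_of_isConnectedSum
    nonempty_homotopyEquiv_sphere_four_left_of_isConnectedSum_holds h₀
    (ψ.toHomeomorph.toHomotopyEquiv.trans e)
  have hZ : IsZero (ModuleCat.of ℤ ℤ) :=
    ((isZero_singularHomology_sphere_holds ℤ ℤ (n := 4) (k := 2) two_ne_zero (by norm_num)).of_iso
      (singularHomology.isoOfHomotopyEquiv ℤ ℤ e' 2)).of_iso
      (ComplexProjectivePlane.singularHomologyTwoIso ℤ ℤ).symm
  have h1 : ((𝟙 (ModuleCat.of ℤ ℤ) : ModuleCat.of ℤ ℤ ⟶ ModuleCat.of ℤ ℤ).hom (1 : ℤ)) = 0 := by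
    rw [hZ.eq_of_src (𝟙 _) 0]; rfl
  simp at h1

/-! ### Meier–Schirmer–Zupan's Thm. 1.2 implies its homotopy-sphere corollary -/

/-- **`msz_trisection_classification_gk ⟹ msz_homotopySphere_gk`** (same universe).  Let `X` be a
closed connected oriented smooth homotopy 4-sphere with a `(g; k₀, k₁, k₂)`-trisection and some
`kᵢ + 1 ≥ g`.  By the classification (relabelled, `msz_trisection_classification_gk.of_exists`)
`X` is `#^{k′}(S¹ × S³)` for some `k′` — then `k′ = 0` since `X` is simply connected, i.e.
`X ≅ S⁴` (`IsCircleProdSum.nonempty_diffeomorph_sphere_of_simplyConnectedSpace`) — or `X` is a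
connected sum `M # ℂP²`, which a homotopy 4-sphere is not
(`not_isConnectedSum_complexProjectivePlane_of_homotopyEquiv_sphere_four`).  This is the
sentence "a homotopy sphere among these is `S⁴`" of the docstring of `msz_homotopySphere_gk`.
[cite: MeierSchirmerZupan2016, Thm. 1.2 and Cor. 1.3] [cite: Kosinski1993, Ch. VI §2, Prop. 2.1] -/
theorem msz_homotopySphere_gk_of_classification (h : msz_trisection_classification_gk.{u}) :
    msz_homotopySphere_gk.{u} := by
  intro X _ _ _ _ _ _ _ o g k S hT hk e
  haveI : SimplyConnectedSpace (Metric.sphere (0 : EuclideanSpace ℝ (Fin (4 + 1))) 1) :=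
    simplyConnectedSpace_sphere_four_holds
  haveI : SimplyConnectedSpace X := e.simplyConnectedSpace
  obtain ⟨k', hX | ⟨M, _, _, _, _, _, _, _, -, hsum⟩⟩ := h.of_exists o hT hk
  · exact IsCircleProdSum.nonempty_diffeomorph_sphere_of_simplyConnectedSpace hX
  · exact (not_isConnectedSum_complexProjectivePlane_of_homotopyEquiv_sphere_four hsum e).elim

/-- **`msz_trisection_classification_gk` at one universe gives `msz_homotopySphere_gk` at every
universe** (through the PROVED `msz_homotopySphere_gk_of_univ`).
[cite: MeierSchirmerZupan2016, Thm. 1.2 and Cor. 1.3] -/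
theorem msz_homotopySphere_gk_of_classification_univ (h : msz_trisection_classification_gk.{v}) :
    msz_homotopySphere_gk.{u} :=
  msz_homotopySphere_gk_of_univ (msz_homotopySphere_gk_of_classification h)

/-- **The genus-`≤ 2` homotopy-sphere fact from the classification** (for homotopy spheres
`g = k₀ + k₁ + k₂`, so genus `≤ 2` forces some `kᵢ ≥ g − 1`:
`mz_genus_le_two_homotopySphere_gk_of_msz_alone`).
[cite: MeierSchirmerZupan2016, Thm. 1.2 and Remark 3.12] [cite: MeierZupan2017, Thm. 1.2 (arXiv Thm. 1.3)] -/
theorem mz_genus_le_two_homotopySphere_gk_of_classification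
    (h : msz_trisection_classification_gk.{v}) : mz_genus_le_two_homotopySphere_gk.{u} :=
  mz_genus_le_two_homotopySphere_gk_of_msz_alone (msz_homotopySphere_gk_of_classification_univ h)

/-- **`LargeKTrisectionBarrier` from the classification**: no exotic 4-sphere has a trisection
with a sector of `kᵢ ≥ g − 1` one-handles. [cite: MeierSchirmerZupan2016, Thm. 1.2] -/
theorem largeKTrisectionBarrier_of_classification (h : msz_trisection_classification_gk.{v}) :
    LargeKTrisectionBarrier :=
  largeKTrisectionBarrier_of_msz (msz_homotopySphere_gk_of_classification_univ h)

/-- **`LowGenusTrisectionBarrier` from the classification**: no exotic 4-sphere has a trisection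
of genus `≤ 2`. [cite: MeierSchirmerZupan2016, Thm. 1.2 and Remark 3.12] -/
theorem lowGenusTrisectionBarrier_of_classification (h : msz_trisection_classification_gk.{v}) :
    LowGenusTrisectionBarrier :=
  lowGenusTrisectionBarrier_of_msz_alone (msz_homotopySphere_gk_of_classification_univ h)

/-! ### Aranda–Zupan's fact with the classification in place of `msz_homotopySphere_gk` -/

/-- **Aranda–Zupan's homotopy-sphere fact, at every universe, from the Meier–Schirmer–Zupan
classification (any universe), the separating splitting fact, the `π₁`-shadow of the
non-separating case and the irreducible five-chain core (the last three at universe `0`)** — the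
assembly `az2025_weaklyReducible_genusThree_homotopySphere_gk_of_facts_zero_of_pi1_zero_of_irreducible_zero`
fed with `msz_homotopySphere_gk_of_classification_univ`.
[cite: ArandaZupan2025, Thm. 1.3 (p. 2), Prop. 2.6, §6 (pp. 20–24)] [cite: MeierSchirmerZupan2016, Thm. 1.2] -/
theorem az2025_weaklyReducible_genusThree_homotopySphere_gk_of_classification_of_sep_of_pi1_of_irreducible
    (hC : msz_trisection_classification_gk.{v})
    (hsep₀ : isConnectedSum_of_reducing_separating.{0})
    (hπ₀ : ∀ (X : Type) [TopologicalSpace X] [T2Space X] [SecondCountableTopology X]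
      [ChartedSpace (EuclideanSpace ℝ (Fin 4)) X] [IsManifold (𝓡 4) ∞ X] [CompactSpace X]
      [ConnectedSpace X] (_ : SmoothOrientation (𝓡 4) X) (g : ℕ) (k : Fin 3 → ℕ)
      (S : Fin 3 → Set X) (δ : Set X), IsGKTrisection X g k S → IsCurve S δ →
      (¬ ∃ e : Metric.closedBall (0 : EuclideanSpace ℝ (Fin 2)) 1 → X,
        Manifold.IsSmoothEmbedding (𝓡∂ 2) (𝓡 4) ∞ e ∧ range e ⊆ centralSurfaceSet S ∧
          e '' (𝓡∂ 2).boundary (Metric.closedBall (0 : EuclideanSpace ℝ (Fin 2)) 1) = δ) →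
      (∀ q : Fin 3, BoundsDisc S (spineHandlebody S q) δ) → IsNonSeparating S δ →
      ¬ SimplyConnectedSpace X)
    (hirr₀ : ∀ (X : Type) [TopologicalSpace X] [T2Space X] [SecondCountableTopology X]
      [ChartedSpace (EuclideanSpace ℝ (Fin 4)) X] [IsManifold (𝓡 4) ∞ X] [CompactSpace X]
      [ConnectedSpace X] (_ : SmoothOrientation (𝓡 4) X) (S : Fin 3 → Set X),
      IsBalancedGKTrisection X 3 1 S →
      (∃ c c' : Set X, IsCurve S c ∧ IsCurve S c' ∧ Disjoint c c' ∧
        IsNonSeparating S c ∧ IsNonSeparating S c' ∧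
        BoundsDisc S (spineHandlebody S 0) c ∧ BoundsDisc S (spineHandlebody S 1) c' ∧
        BoundsDisc S (spineHandlebody S 2) c') →
      ¬ IsReducible S → X ≃ₕ (Metric.sphere (0 : EuclideanSpace ℝ (Fin (4 + 1))) 1) →
        Nonempty (X ≃ₘ⟮𝓡 4, 𝓡 4⟯ (Metric.sphere (0 : EuclideanSpace ℝ (Fin (4 + 1))) 1))) :
    az2025_weaklyReducible_genusThree_homotopySphere_gk.{u} :=
  az2025_weaklyReducible_genusThree_homotopySphere_gk_of_facts_zero_of_pi1_zero_of_irreducible_zero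
    (msz_homotopySphere_gk_of_classification_univ hC) hsep₀ hπ₀ hirr₀

end Literature.Barriers.SmoothPoincare4

end
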